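import Summits.BirchSwinnertonDyer.BirchSwinnertonDyer.Theorems.AdditiveBranchIMCGordTwoRankOneShaAnUnit
import Summits.BirchSwinnertonDyer.BirchSwinnertonDyer.Theorems.AdditiveBranchIMCGordTwoRankOneIndexRecord
import HarnessLib

/-!
# Route `AdditiveBranchIMC` (rung K1), crux `GordTwoRankOne` (item 19358): `BSD(E,p)` doors on B6 WITHOUT the table
# datum — the `#Ш_an`-unit window read from an exact Heegner-index record (composition of `…ShaAnUnit` §1–§2 with
# `…IndexRecord` §1) (cell `bsd-addord`, seat `bsd-addord-k1-c3` gen 5, D-0074 row B2)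

HONEST FRAMING. THEOREMS ONLY (six compositions, one `obtain` each): no definition, no named fact, no `sorry`,
nothing booked; BSD is not proved by any of this; the crux stays OPEN at class level on its content window.

WHAT. `…ShaAnUnit` gives `BSD(E,p)` on X4♯ ∩ surj (Kato's half `hK`) and X3♯ (Wuthrich's half `hW16`) rank-one rows
from the cite-only facts of the kernel identity, `A′ ≠ 0`, and the per-pair DATUM `#Ш(E)_an = s`, `ord_p s ≤ 0`;
`…IndexRecord` produces exactly that datum IN THE KERNEL from an exact Heegner-index record via the Gross–Zagier
bookkeeping identity (x11b `X11b.exists_shaAn_padicVal_eq_of_heegner`; PUBLISHED binders `hGZ` Gross–Zagier V.(2.1),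
`hKo` Kolyvagin, `hGZK`, `hmod`; EXACT data: Heegner field `K` with `p ∤ #𝓞_K^×`, parametrisation datum `Dt` with
`p ∤ c(Dt)`, Heegner point `P`, minimal twist model `Wd` with `ord_p u = 0`, the twist's central value `q_d ∈ ℚ^×`, and
the record inequality `2·ord_p [E(K):ℤP] ≤ ord_p q_d + ord_p ∏c_ℓ(E)` (`+ 2·ord_p #Wd(ℚ)_tors` on reducible rows)).
Here: the six doors BY NAME with the record in place of the datum —
`classX4Gord_bsdp_rankOne{,_odd,_three}_of_katoHalf_of_branchCoeffOneNeZero_of_indexRecord` (torsion term absent: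
`E[p]` irreducible) and `classX3Gord_bsdp_rankOne{,_odd,_three}_of_wuthrichHalf_of_branchCoeffOneNeZero_of_indexRecord`
(torsion term kept). So a B6 (G-ord, `e = 2`) rank-one key is `BSD(E,p)` from: ONE reading (`hK` | `hW16`), the
cite-only facts `hCyc hArt h73 hWald hmod hmodD hmodN hGZK hGZ hKo`, the weak certificate `A′ ≠ 0`, and EXACT
Heegner-index data — no table value of `#Ш_an`, no line datum, no unit coefficient, no non-anomalous binder.

NOT here: any evaluation of an index / `q_d` / Manin constant (`p ∤ c(Dt)` is a genuine per-pair input at an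
additive `p` — Mazur 1978 Cor. 4.1 needs `p² ∤ 4N`); any class statement; any booking.

References: [JetchevSkinnerWan2017] §7.3.1, §7.4.1; [GrossZagier1986] V.§2; [KolyvaginEulerSystems1990] Thm. A;
[Kato2004Asterisque] Thm. 17.4 (3); [Wuthrich2014] Thm. 16; [Delbourgo2002] Thm. (B); [Disegni2017] Thm. A, B;
[Miller2011LMS] §1, Def. 1.1; HOME/k1-c3/CERT-ROADS-19358-g5.md.
-/

set_option autoImplicit false
set_option linter.dupNamespace false
noncomputable section
open scoped Classical MatrixGroups ModularForm NumberField
open CongruenceSubgroup WeierstrassCurve NumberField IsDedekindDomain Field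
  Literature.NumberTheory.EllipticCurves Literature.NumberTheory.EllipticCurves.ModularForms
  Literature.NumberTheory.EllipticCurves.GreenbergVatsal2000
  Literature.NumberTheory.EllipticCurves.Rank1Residual
  Literature.NumberTheory.EllipticCurves.Rank1Residual.Typed
  Literature.NumberTheory.EllipticCurves.Delbourgo2002
  Literature.NumberTheory.EllipticCurves.Disegni2017
  Literature.NumberTheory.GaloisRepresentations
  Literature.NumberTheory.QuadraticFields
  Summit.BirchSwinnertonDyer.Rank1Residual.AdditivePotMult
  Summit.BirchSwinnertonDyer.Rank1Residual.Additive
  Summit.BirchSwinnertonDyer.Rank1Residual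

namespace Summit.BirchSwinnertonDyer.BirchSwinnertonDyer.Theorems.AdditiveBranchIMCGordTwoRankOne

section Doors

variable {W : WeierstrassCurve ℚ} [W.IsElliptic] [W.IsGloballyMinimal]
  {N : ℕ} [NeZero N] {K : Type} [Field K] [NumberField K]
  (Dt : ModularParametrizationData W N) (H : HeegnerDatum N (NumberField.discr K)) (ι : K →+* ℂ)
  (P : (W.baseChange K).toAffine.Point)
  (hGZ : gross_zagier N W K) (hKo : kolyvagin N W K)
  (hK : IsImaginaryQuadratic K) (hHN : SatisfiesHeegnerHypothesis N K)
  (hP : WeierstrassCurve.Affine.Point.map ι.toRatAlgHom P = heegnerPointComplex Dt H)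
  (Wd : WeierstrassCurve ℚ) [Wd.IsElliptic] [Wd.IsGloballyMinimal] (Cd : VariableChange ℚ)
  (hWd : Cd • W.quadraticTwist (NumberField.discr K : ℚ) = Wd)
  (qd : ℚ) (hqd : Wd.entireLFunction 1 / (Wd.realPeriodRat : ℂ) = (qd : ℂ)) (hqd0 : qd ≠ 0)

include hGZ hKo hK hHN hP hWd hqd hqd0

/-! ### §1 X4♯(G-ord) ∩ `I₀*` ∩ {`ρ̄` onto}: Kato's half + `A′ ≠ 0` + index record (no torsion term) -/

/-- **X4♯(G-ord) ∩ `I₀*` ∩ {`ρ̄_{E,p}` onto}, `p ≡ 1 (mod 4)`, `r_an(E) = 1`: `BSD(E,p)` from Kato's half `hK`, the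
cite-only facts, `A′ ≠ 0`, and the exact Heegner-index record `2·ord_p [E(K):ℤP] ≤ ord_p q_d + ord_p ∏c_ℓ(E)`**
(data as in `missingLowerBoundAt_of_indexRecord`; `E[p]` irreducible from X4). One `obtain`:
`X11b.exists_shaAn_padicValRat_le_zero_of_indexRecord` ∘ `…_of_shaAnUnit`. Nothing booked.
[cite: JetchevSkinnerWan2017, §7.4.1 (eq:gz for K′), pp. 29–30] [cite: Kato2004Asterisque, Thm. 17.4 (3) (p. 273)]
[cite: Miller2011LMS, Def. 1.1] -/
theorem classX4Gord_bsdp_rankOne_of_katoHalf_of_branchCoeffOneNeZero_of_indexRecord {p : ℕ} [Fact p.Prime]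
    (hKt : Wuthrich2014.kato_halfEigenCharIdeal_dvd_cyclotomicPrime_of_surjective)
    (hCyc : delbourgoDatum_cycLineGrossZagier)
    (hArt : rankinSelbergEulerProductHecke_baseChangeDirichlet_eq) (h73 : GrossZagier1986_thm_I_7_3)
    (hWald : waldspurger_exists_heegnerField_twist_ne_zero)
    (hmod : hasEntireLFunction_rat) (hmodD : nonempty_modularParametrizationData)
    (hmodN : exists_isNewformOf) (hGZK : rank_eq_analyticRank_of_analyticRank_le_one)
    (hX : ClassX4Gord W p) (he : semistabilityIndex W p = 2) (hp4 : p % 4 = 1) (hsurj : Surj W p)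
    (hr : W.analyticRank = 1) (hne : BranchCoeffOneNeZeroAt W p)
    (hc : ¬ (p : ℤ) ∣ Dt.c) (hμ : ¬ p ∣ Units.torsionOrder K) (hu : padicValRat p (Cd.u : ℚ) = 0)
    (hrec : 2 * (padicValNat p (AddSubgroup.zmultiples P).index : ℤ) ≤
      padicValRat p qd + padicValNat p W.tamagawaProduct) : BSDp W p := by
  obtain ⟨s, hs, hsv⟩ := X11b.exists_shaAn_padicValRat_le_zero_of_indexRecord W p N K Dt H ι P hGZ hKo hGZK
    hmod hK hHN hP hX.addv.1 hc hμ hr hX.classX4.2.2 Wd Cd hWd hu qd hqd hqd0 hrec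
  exact classX4Gord_bsdp_rankOne_of_katoHalf_of_branchCoeffOneNeZero_of_shaAnUnit hKt hCyc hArt h73 hWald hmod
    hmodD hmodN hGZK hX he hp4 hsurj hr hne hs hsv

/-- **Odd branch** (`p ≡ 3 (mod 4)`, `p ≥ 7`): the same door with the record in place of the datum.
[cite: JetchevSkinnerWan2017, §7.4.1 (eq:gz for K′), pp. 29–30] [cite: Kato2004Asterisque, Thm. 17.4 (3) (p. 273)]
[cite: Miller2011LMS, Def. 1.1] -/
theorem classX4Gord_bsdp_rankOne_odd_of_katoHalf_of_branchCoeffOneNeZero_of_indexRecord {p : ℕ} [Fact p.Prime]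
    (hKt : Wuthrich2014.kato_halfEigenCharIdeal_dvd_cyclotomicPrime_of_surjective)
    (hCyc : delbourgoDatum_cycLineGrossZagier)
    (hArt : rankinSelbergEulerProductHecke_baseChangeDirichlet_eq) (h73 : GrossZagier1986_thm_I_7_3)
    (hWald : waldspurger_exists_heegnerField_twist_ne_zero)
    (hmod : hasEntireLFunction_rat) (hmodD : nonempty_modularParametrizationData)
    (hmodN : exists_isNewformOf) (hGZK : rank_eq_analyticRank_of_analyticRank_le_one)
    (hX : ClassX4Gord W p) (he : semistabilityIndex W p = 2) (hp4 : p % 4 = 3) (hp5 : 5 ≤ p) (hsurj : Surj W p)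
    (hr : W.analyticRank = 1) (hne : BranchCoeffOneNeZeroAt W p)
    (hc : ¬ (p : ℤ) ∣ Dt.c) (hμ : ¬ p ∣ Units.torsionOrder K) (hu : padicValRat p (Cd.u : ℚ) = 0)
    (hrec : 2 * (padicValNat p (AddSubgroup.zmultiples P).index : ℤ) ≤
      padicValRat p qd + padicValNat p W.tamagawaProduct) : BSDp W p := by
  obtain ⟨s, hs, hsv⟩ := X11b.exists_shaAn_padicValRat_le_zero_of_indexRecord W p N K Dt H ι P hGZ hKo hGZK
    hmod hK hHN hP hX.addv.1 hc hμ hr hX.classX4.2.2 Wd Cd hWd hu qd hqd hqd0 hrec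
  exact classX4Gord_bsdp_rankOne_odd_of_katoHalf_of_branchCoeffOneNeZero_of_shaAnUnit hKt hCyc hArt h73 hWald
    hmod hmodD hmodN hGZK hX he hp4 hp5 hsurj hr hne hs hsv

/-- **`p = 3`**: the same door with the record in place of the datum (anomalous or not).
[cite: JetchevSkinnerWan2017, §7.4.1 (eq:gz for K′), pp. 29–30] [cite: Kato2004Asterisque, Thm. 17.4 (3) (p. 273)]
[cite: Miller2011LMS, Def. 1.1] -/
theorem classX4Gord_bsdp_rankOne_three_of_katoHalf_of_branchCoeffOneNeZero_of_indexRecord [Fact (Nat.Prime 3)]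
    (hKt : Wuthrich2014.kato_halfEigenCharIdeal_dvd_cyclotomicPrime_of_surjective)
    (hCyc : delbourgoDatum_cycLineGrossZagier)
    (hArt : rankinSelbergEulerProductHecke_baseChangeDirichlet_eq) (h73 : GrossZagier1986_thm_I_7_3)
    (hWald : waldspurger_exists_heegnerField_twist_ne_zero)
    (hmod : hasEntireLFunction_rat) (hmodD : nonempty_modularParametrizationData)
    (hmodN : exists_isNewformOf) (hGZK : rank_eq_analyticRank_of_analyticRank_le_one)
    (hX : ClassX4Gord W 3) (hsurj : Surj W 3) (hr : W.analyticRank = 1) (hne : BranchCoeffOneNeZeroAt W 3)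
    (hc : ¬ ((3 : ℕ) : ℤ) ∣ Dt.c) (hμ : ¬ 3 ∣ Units.torsionOrder K) (hu : padicValRat 3 (Cd.u : ℚ) = 0)
    (hrec : 2 * (padicValNat 3 (AddSubgroup.zmultiples P).index : ℤ) ≤
      padicValRat 3 qd + padicValNat 3 W.tamagawaProduct) : BSDp W 3 := by
  obtain ⟨s, hs, hsv⟩ := X11b.exists_shaAn_padicValRat_le_zero_of_indexRecord W 3 N K Dt H ι P hGZ hKo hGZK
    hmod hK hHN hP (by norm_num) hc hμ hr hX.classX4.2.2 Wd Cd hWd hu qd hqd hqd0 hrec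
  exact classX4Gord_bsdp_rankOne_three_of_katoHalf_of_branchCoeffOneNeZero_of_shaAnUnit hKt hCyc hArt h73 hWald
    hmod hmodD hmodN hGZK hX hsurj hr hne hs hsv

/-! ### §2 X3♯(G-ord) ∩ `I₀*`: Wuthrich's half + `A′ ≠ 0` + index record (torsion term kept) -/

/-- **X3♯(G-ord) ∩ `I₀*` (`E[p]` reducible), `p ≡ 1 (mod 4)`, `r_an(E) = 1`, Case-1 line datum or not: `BSD(E,p)` from
Wuthrich's half `hW16`, the cite-only facts, `A′ ≠ 0`, and the record WITH the twist-torsion term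
`2·ord_p [E(K):ℤP] ≤ ord_p q_d + ord_p ∏c_ℓ(E) + 2·ord_p #Wd(ℚ)_tors`** (data as in
`missingLowerBoundAt_of_indexRecord_tors`). Nothing booked.
[cite: JetchevSkinnerWan2017, §7.4.1 (eq:gz for K′), pp. 29–30] [cite: Wuthrich2014, Thm. 16 (p. 397)]
[cite: Miller2011LMS, Def. 1.1] -/
theorem classX3Gord_bsdp_rankOne_of_wuthrichHalf_of_branchCoeffOneNeZero_of_indexRecord {p : ℕ} [Fact p.Prime]
    (hW16 : Wuthrich2014.thm16_halfEigenCharIdeal_dvd_cyclotomicPrime)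
    (hCyc : delbourgoDatum_cycLineGrossZagier)
    (hArt : rankinSelbergEulerProductHecke_baseChangeDirichlet_eq) (h73 : GrossZagier1986_thm_I_7_3)
    (hWald : waldspurger_exists_heegnerField_twist_ne_zero)
    (hmod : hasEntireLFunction_rat) (hmodD : nonempty_modularParametrizationData)
    (hmodN : exists_isNewformOf) (hGZK : rank_eq_analyticRank_of_analyticRank_le_one)
    (hX : ClassX3Gord W p) (he : semistabilityIndex W p = 2) (hp4 : p % 4 = 1) (hr : W.analyticRank = 1)
    (hne : BranchCoeffOneNeZeroAt W p)
    (hc : ¬ (p : ℤ) ∣ Dt.c) (hμ : ¬ p ∣ Units.torsionOrder K) (hu : padicValRat p (Cd.u : ℚ) = 0)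
    (hrec : 2 * (padicValNat p (AddSubgroup.zmultiples P).index : ℤ) ≤
      padicValRat p qd + padicValNat p W.tamagawaProduct + 2 * padicValNat p Wd.torsionOrder) : BSDp W p := by
  have hp2 : p ≠ 2 := by omega
  obtain ⟨s, hs, hsv⟩ := exists_shaAn_padicValRat_le_zero_of_indexRecord_tors W p N K Dt H ι P hGZ hKo hGZK hmod
    hK hHN hP hp2 hc hμ hr Wd Cd hWd hu qd hqd hqd0 hrec
  exact classX3Gord_bsdp_rankOne_of_wuthrichHalf_of_branchCoeffOneNeZero_of_shaAnUnit hW16 hCyc hArt h73 hWald hmod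
    hmodD hmodN hGZK hX he hp4 hr hne hs hsv

/-- **Odd branch, reducible rows** (`p ≡ 3 (mod 4)`, `p ≥ 7`): the same with the record (torsion term kept).
[cite: JetchevSkinnerWan2017, §7.4.1 (eq:gz for K′), pp. 29–30] [cite: Wuthrich2014, Thm. 16 (p. 397)]
[cite: Miller2011LMS, Def. 1.1] -/
theorem classX3Gord_bsdp_rankOne_odd_of_wuthrichHalf_of_branchCoeffOneNeZero_of_indexRecord {p : ℕ} [Fact p.Prime]
    (hW16 : Wuthrich2014.thm16_halfEigenCharIdeal_dvd_cyclotomicPrime)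
    (hCyc : delbourgoDatum_cycLineGrossZagier)
    (hArt : rankinSelbergEulerProductHecke_baseChangeDirichlet_eq) (h73 : GrossZagier1986_thm_I_7_3)
    (hWald : waldspurger_exists_heegnerField_twist_ne_zero)
    (hmod : hasEntireLFunction_rat) (hmodD : nonempty_modularParametrizationData)
    (hmodN : exists_isNewformOf) (hGZK : rank_eq_analyticRank_of_analyticRank_le_one)
    (hX : ClassX3Gord W p) (he : semistabilityIndex W p = 2) (hp4 : p % 4 = 3) (hp5 : 5 ≤ p)
    (hr : W.analyticRank = 1) (hne : BranchCoeffOneNeZeroAt W p)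
    (hc : ¬ (p : ℤ) ∣ Dt.c) (hμ : ¬ p ∣ Units.torsionOrder K) (hu : padicValRat p (Cd.u : ℚ) = 0)
    (hrec : 2 * (padicValNat p (AddSubgroup.zmultiples P).index : ℤ) ≤
      padicValRat p qd + padicValNat p W.tamagawaProduct + 2 * padicValNat p Wd.torsionOrder) : BSDp W p := by
  have hp2 : p ≠ 2 := by omega
  obtain ⟨s, hs, hsv⟩ := exists_shaAn_padicValRat_le_zero_of_indexRecord_tors W p N K Dt H ι P hGZ hKo hGZK hmod
    hK hHN hP hp2 hc hμ hr Wd Cd hWd hu qd hqd hqd0 hrec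
  exact classX3Gord_bsdp_rankOne_odd_of_wuthrichHalf_of_branchCoeffOneNeZero_of_shaAnUnit hW16 hCyc hArt h73 hWald
    hmod hmodD hmodN hGZK hX he hp4 hp5 hr hne hs hsv

/-- **`p = 3`, reducible rows**: the same with the record (torsion term kept), anomalous or not, line datum or not.
[cite: JetchevSkinnerWan2017, §7.4.1 (eq:gz for K′), pp. 29–30] [cite: Wuthrich2014, Thm. 16 (p. 397)]
[cite: Miller2011LMS, Def. 1.1] -/
theorem classX3Gord_bsdp_rankOne_three_of_wuthrichHalf_of_branchCoeffOneNeZero_of_indexRecord [Fact (Nat.Prime 3)]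
    (hW16 : Wuthrich2014.thm16_halfEigenCharIdeal_dvd_cyclotomicPrime)
    (hCyc : delbourgoDatum_cycLineGrossZagier)
    (hArt : rankinSelbergEulerProductHecke_baseChangeDirichlet_eq) (h73 : GrossZagier1986_thm_I_7_3)
    (hWald : waldspurger_exists_heegnerField_twist_ne_zero)
    (hmod : hasEntireLFunction_rat) (hmodD : nonempty_modularParametrizationData)
    (hmodN : exists_isNewformOf) (hGZK : rank_eq_analyticRank_of_analyticRank_le_one)
    (hX : ClassX3Gord W 3) (hr : W.analyticRank = 1) (hne : BranchCoeffOneNeZeroAt W 3)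
    (hc : ¬ ((3 : ℕ) : ℤ) ∣ Dt.c) (hμ : ¬ 3 ∣ Units.torsionOrder K) (hu : padicValRat 3 (Cd.u : ℚ) = 0)
    (hrec : 2 * (padicValNat 3 (AddSubgroup.zmultiples P).index : ℤ) ≤
      padicValRat 3 qd + padicValNat 3 W.tamagawaProduct + 2 * padicValNat 3 Wd.torsionOrder) : BSDp W 3 := by
  obtain ⟨s, hs, hsv⟩ := exists_shaAn_padicValRat_le_zero_of_indexRecord_tors W 3 N K Dt H ι P hGZ hKo hGZK hmod
    hK hHN hP (by norm_num) hc hμ hr Wd Cd hWd hu qd hqd hqd0 hrec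
  exact classX3Gord_bsdp_rankOne_three_of_wuthrichHalf_of_branchCoeffOneNeZero_of_shaAnUnit hW16 hCyc hArt h73
    hWald hmod hmodD hmodN hGZK hX hr hne hs hsv

end Doors

end Summit.BirchSwinnertonDyer.BirchSwinnertonDyer.Theorems.AdditiveBranchIMCGordTwoRankOne

end
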